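import Literature.AlgebraicGeometry.Resolution.AffineBlowupAlgebra
import Literature.RingTheory.FittingIdeal.PrincipalTorsion
import Literature.RingTheory.FittingIdeal.BaseChange
import Mathlib.RingTheory.LocalRing.Basic
import HarnessLib

/-!
# Blowing up a Fitting ideal: the strict transform is locally generated by `r` elements
# (Stacks 0810, Step 8; Raynaud–Gruson 5.4.2)

Topic: `Literature/AlgebraicGeometry/Resolution`. The local computation at the heart of
flattening by blowing up Fitting ideals (Raynaud–Gruson 1971, Première partie, 5.4; The Stacks
Project, Tag 0810, proof, Step 8: "we find that `J S'_{𝔮'}` is the principal ideal generated by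
the nonzerodivisor `a'` […] by More on Algebra, Lemma 15.8.9 [= Tag 080Z] `M'_{𝔮'}` can be
generated by `r` elements"), in the basic case `S = R`: let `M` be a finite `R`-module with
`Fit_r(M) = I`, let `a ∈ I` and let `R' = R[I/a]` be the affine blowup algebra (the chart of the
blowing up of `Spec R` in `I` on which `I R' = a R'`, Stacks 07Z3 (2),
`map_blowupAlgebra_eq_span`). Then for every prime `𝔭'` of `R'`, the module
`(R'_{𝔭'} ⊗_R M) / {x ∣ a x = 0}` — and a fortiori the strict transform
`(R'_{𝔭'} ⊗_R M)/(a-power torsion)` (Stacks 080C) — is generated by `r` elements: Fitting ideals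
commute with base change (Stacks 07ZA (3), `Module.fittingIdeal_baseChange`), so
`Fit_r(R'_{𝔭'} ⊗_R M) = I R'_{𝔭'} = (a)` is principal over the local ring `R'_{𝔭'}`, and
Stacks 080Z (`Module.exists_span_eq_top_quotient_torsionBy`, `PrincipalTorsion.lean`) applies.

* `exists_span_eq_top_quotient_of_le` — generation by `r` elements passes to further quotients;
* `exists_span_eq_top_quotient_torsionBy_of_map_eq_span` — abstract form: `S` a local
  `R`-algebra with `I S = (a)`;
* `exists_span_eq_top_quotient_torsionBy_blowupAlgebra` — **for a local algebra `S` over the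
  chart `R[I/a]` (e.g. `R[I/a]_{𝔭'}`), the `a`-torsion quotient of `S ⊗_R M` is generated by
  `r` (the index of the blown-up Fitting ideal) elements;**
* `exists_span_eq_top_quotient_powTorsion_blowupAlgebra` — the same for the quotient by the
  `a`-power torsion (the local strict transform of `M`).
(Stated for an arbitrary local algebra `S` over the chart rather than for `Localization.AtPrime`
itself, which also avoids an instance diamond on tensor products with `OreLocalization`.)

## References

* The Stacks Project, Tag 0810 (More on Flatness, Lemma 38.30.2), proof, Step 8; Tags 080Z,
  07ZA, 07Z3, 080C. [StacksProject]
* M. Raynaud, L. Gruson, *Critères de platitude et de projectivité*, Invent. Math. 13 (1971),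
  Première partie, 5.4.2. [RaynaudGruson1971]
-/

namespace Literature.AlgebraicGeometry.Resolution

universe u v

open TensorProduct Literature.RingTheory.FittingIdeal

/-- Generation by `r` elements passes to further quotients. [folklore] -/
theorem exists_span_eq_top_quotient_of_le {A : Type u} [CommRing A] {N : Type v} [AddCommGroup N]
    [Module A N] {T₁ T₂ : Submodule A N} (h : T₁ ≤ T₂) {r : ℕ}
    (hy : ∃ y : Fin r → N ⧸ T₁, Submodule.span A (Set.range y) = ⊤) :
    ∃ z : Fin r → N ⧸ T₂, Submodule.span A (Set.range z) = ⊤ := by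
  obtain ⟨y, hy⟩ := hy
  let q : (N ⧸ T₁) →ₗ[A] N ⧸ T₂ := Submodule.mapQ T₁ T₂ LinearMap.id h
  have hq : Function.Surjective q := by
    intro z
    induction z using Submodule.Quotient.induction_on with
    | H n => exact ⟨Submodule.Quotient.mk n, rfl⟩
  refine ⟨q ∘ y, ?_⟩
  rw [Set.range_comp, Submodule.span_image, hy, Submodule.map_top, LinearMap.range_eq_top.mpr hq]

variable {R : Type u} [CommRing R] {M : Type u} [AddCommGroup M] [Module R M]

/-- **Stacks 0810, Step 8, abstract form:** let `M` be a finite `R`-module with `Fit_r(M) = I`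
and let `S` be a LOCAL `R`-algebra in which `I S` is the principal ideal generated by (the
image of) `a ∈ R` — e.g. any local ring of the chart `R[I/a]` of the blowing up in `I`
(Stacks 07Z3 (2)). Then `(S ⊗_R M) / {x ∣ a x = 0}` is generated by `r` elements: Fitting
ideals commute with base change (Stacks 07ZA (3)), so `Fit_r(S ⊗_R M) = I S = (a)`, and
Stacks 080Z applies. [cite: StacksProject, Tag 0810 (proof, Step 8)] -/
theorem exists_span_eq_top_quotient_torsionBy_of_map_eq_span [Module.Finite R M] {r : ℕ}
    {I : Ideal R} (hI : Module.fittingIdeal R M r = I) (S : Type u) [CommRing S] [IsLocalRing S]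
    [Algebra R S] {a : R} (hIS : I.map (algebraMap R S) = Ideal.span {algebraMap R S a}) :
    ∃ y : Fin r → (S ⊗[R] M) ⧸ Submodule.torsionBy S (S ⊗[R] M) (algebraMap R S a),
      Submodule.span S (Set.range y) = ⊤ := by
  refine Module.exists_span_eq_top_quotient_torsionBy (R := S) (M := S ⊗[R] M) ?_
  rw [Module.fittingIdeal_baseChange, hI, hIS]

/-- **Raynaud–Gruson 5.4.2 / Stacks 0810, Step 8 (basic case) on the chart `R[I/a]`:** let `M`
be a finite `R`-module with `Fit_r(M) = I`, `a ∈ I`, and `S` a local algebra over the affine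
blowup algebra `R' = R[I/a]` (compatibly with `R`; e.g. `S = R'_{𝔭'}` for a prime `𝔭'` of
`R'`). Then `(S ⊗_R M) / {x ∣ a x = 0}` is generated by `r` elements (`I R' = a R'`,
Stacks 07Z3 (2), `map_blowupAlgebra_eq_span`). [cite: StacksProject, Tag 0810 (proof, Step 8)] -/
theorem exists_span_eq_top_quotient_torsionBy_blowupAlgebra [Module.Finite R M] {r : ℕ}
    {I : Ideal R} (hI : Module.fittingIdeal R M r = I) {a : R} (ha : a ∈ I)
    (S : Type u) [CommRing S] [IsLocalRing S] [Algebra R S] [Algebra (blowupAlgebra I a) S]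
    [IsScalarTower R (blowupAlgebra I a) S] :
    ∃ y : Fin r → (S ⊗[R] M) ⧸ Submodule.torsionBy S (S ⊗[R] M) (algebraMap R S a),
      Submodule.span S (Set.range y) = ⊤ := by
  refine exists_span_eq_top_quotient_torsionBy_of_map_eq_span hI S ?_
  rw [IsScalarTower.algebraMap_eq R (blowupAlgebra I a) S, ← Ideal.map_map,
    map_blowupAlgebra_eq_span ha, Ideal.map_span, Set.image_singleton]
  rfl

/-- **The local strict transform is generated by `r` elements**: in the situation of
`exists_span_eq_top_quotient_torsionBy_blowupAlgebra`, also the quotient of `S ⊗_R M` by its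
`a`-power torsion `{x ∣ ∃ n, aⁿ x = 0}` (for `S = R'_{𝔭'}` the stalk at `𝔭'` of the strict
transform of `M̃` along the blowing up in `Fit_r(M)`, Stacks 080C) is generated by `r`
elements. [cite: StacksProject, Tag 0810 (proof, Step 8)] -/
theorem exists_span_eq_top_quotient_powTorsion_blowupAlgebra [Module.Finite R M] {r : ℕ}
    {I : Ideal R} (hI : Module.fittingIdeal R M r = I) {a : R} (ha : a ∈ I)
    (S : Type u) [CommRing S] [IsLocalRing S] [Algebra R S] [Algebra (blowupAlgebra I a) S]
    [IsScalarTower R (blowupAlgebra I a) S] :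
    ∃ y : Fin r → (S ⊗[R] M) ⧸
        (⨆ n : ℕ, Submodule.torsionBy S (S ⊗[R] M) (algebraMap R S a ^ n)),
      Submodule.span S (Set.range y) = ⊤ := by
  refine exists_span_eq_top_quotient_of_le ?_
    (exists_span_eq_top_quotient_torsionBy_blowupAlgebra hI ha S)
  conv_lhs => rw [← pow_one (algebraMap R S a)]
  exact le_iSup (fun n : ℕ => Submodule.torsionBy S (S ⊗[R] M) (algebraMap R S a ^ n)) 1

end Literature.AlgebraicGeometry.Resolution
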